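import Summits.HubbardSuperconductivity.HubbardSuperconductivity.Theorems.AnisotropyChordTransferFibre3FinXB2Eval

/-!
# Route `AnisotropyChord` / H0 rotor rung: FIN per-`L` evaluator XD of the ROW-D crux (`LowShellGFormAbs`, KT-2a″) — computable, zero data

The kernel evaluator of the per-`L` row-D certificate (FIN route (b), R1 range `9 ≤ L ≤ 47`; design: mechhunt STATUS p3 g7 CLAIM,
float oracle `scratch/xd_mirror.py` = lib21 brute force to 1e-11).  On one `λ·D`-cell `[la, lb]` it bounds
`lowG = Σ_{k ∈ lowSet} |R̂′(k)|² / (V² den(k))` for the ground profile by the UNCANCELLED one-loop form of the 45 low residual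
coefficients (`lowGRowForm_holds'`: `R̂′ = den·Ψ̂¹ − Δ·FTW + Bd`), every lattice sum enclosed on the cell by MONOTONICITY in `λ`
(`gres ≥ 0` and increasing) from two POINT tables at the cell ends (literal tables certified in separate declarations and shared by
adjacent cells, exactly as the XB2 point wedges), the scalars and `T⁺` from g5's `xbEval`:
* key lists (L-independent, from `lowList`): `keys3` (the 78 momentum pairs `(q₂,q₃)` of `Ψ̂¹ = Π̂(k) + Π̂(k₂−K₁,k₃) + Π̂(k₂,k₃−K₁)`),
  `keysQ` (the 21 momenta of the two-propagator sums `T(q) = Σ_p g(p)g(p+q)` and of the twisted sums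
  `W(q) = Σ_p e^{ip₁θ} g(p)g(q−p)`; the directions `−x̂, ±ŷ` are conjugates / transposes);
* the point table `xdPoint L lam : XDPt` at `λ·D = lam` (exact big-integer accumulation, one outward rounding per entry):
  `T(q)`, `G₃(q₂,q₃) = Σ_p g(p)g(p+q₂)g(p−q₃)`, `W(q)` (re, im);
* the cell evaluator: `Π̂` by `piHat_expansion_ground` (closed polynomial in `A = V + a`, `B(q) = −a − c_s g(q)` plus `S₁, T, G₃`),
  the pair transforms `V·Y_e(q) = A²δ(q) + A B(q)(1 + e^{−iq·e}) + a c_s V G̃(x̂)(1 + e^{−iq·e}) + c_s² e^{−iq·e} W_e(q)`,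
  `FTW`, `Bd` as in `…KT2aRow`, `den = Σε − ε₁ − 3λ − Q/P` (`T⁺ − 3λ₂ = ⟨Π⁰,C0⟩/‖Π⁰‖²`), the box of `R̂′(k)`, `|R̂′(k)|²⁺`,
  and the certificate `xdCellOK L la lb aD ptLo ptHi`:  `Σ_k |R̂′|²⁺/den⁻ ≤ aD · V² · η_eff⁻ · U⁻` in exact rationals.
Prover seat `hubbard-h0-rotor-p3` g7; helper for piece A = stmt-HubbardSuperconductivity-23918 of rung 19089 (`--supports`, helper
class).  WHAT THIS IS NOT: nothing here proves superconductivity in the Hubbard model (rotor TARGET as worded stays FALSE, g15 verdict);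
evaluator infrastructure for the FIN certificates of ONE conditional reduction.  Tree imports only; no sorry, no new axioms.
-/

set_option linter.dupNamespace false
set_option autoImplicit false

namespace Summit.HubbardSuperconductivity.HubbardSuperconductivity.Theorems.AnisotropyChord.Transfer.Fibre3

namespace FinXD

open Hole2 FinCell FinXB

/-! ## Key lists (L-independent) -/

/-- the 45 low momenta `(k₂, k₃)` (a copy of `lowList`, integer representatives). -/
def xdLow : List ((ℤ × ℤ) × (ℤ × ℤ)) :=
  [((-1,0),(1,0)), ((0,-1),(0,0)), ((0,-1),(0,1)), ((0,-1),(1,0)), ((0,-1),(1,1)), ((0,0),(0,-1)), ((0,0),(0,1)),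
   ((0,0),(1,-1)), ((0,0),(1,1)), ((0,1),(0,-1)), ((0,1),(0,0)), ((0,1),(1,-1)), ((0,1),(1,0)), ((1,-1),(0,0)),
   ((1,-1),(0,1)), ((1,0),(-1,0)), ((1,0),(0,-1)), ((1,0),(0,1)), ((1,0),(1,0)), ((1,1),(0,-1)), ((1,1),(0,0)),
   ((-1,-1),(1,0)), ((-1,-1),(1,1)), ((-1,0),(0,0)), ((-1,0),(1,-1)), ((-1,0),(1,1)), ((-1,0),(2,0)), ((-1,1),(1,-1)),
   ((-1,1),(1,0)), ((0,0),(-1,0)), ((0,0),(2,0)), ((1,-1),(-1,0)), ((1,-1),(-1,1)), ((1,-1),(1,0)), ((1,-1),(1,1)),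
   ((1,0),(-1,-1)), ((1,0),(-1,1)), ((1,0),(1,-1)), ((1,0),(1,1)), ((1,1),(-1,-1)), ((1,1),(-1,0)), ((1,1),(1,-1)),
   ((1,1),(1,0)), ((2,0),(-1,0)), ((2,0),(0,0))]

/-- the three momentum pairs of `Ψ̂¹(k)`: `(k₂,k₃)`, `(k₂−K₁,k₃)`, `(k₂,k₃−K₁)`. -/
def trans3 (k : (ℤ × ℤ) × (ℤ × ℤ)) : List ((ℤ × ℤ) × (ℤ × ℤ)) :=
  [k, ((k.1.1 - 1, k.1.2), k.2), (k.1, (k.2.1 - 1, k.2.2))]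

/-- the 78 momentum pairs at which `Π̂` is needed. -/
def keys3 : List ((ℤ × ℤ) × (ℤ × ℤ)) :=
  [((-1, 0), (1, 0)), ((-2, 0), (1, 0)), ((-1, 0), (0, 0)), ((0, -1), (0, 0)), ((-1, -1), (0, 0)), ((0, -1), (-1, 0)), ((0, -1), (0, 1)),
   ((-1, -1), (0, 1)), ((0, -1), (-1, 1)), ((0, -1), (1, 0)), ((-1, -1), (1, 0)), ((0, -1), (1, 1)), ((-1, -1), (1, 1)), ((0, 0), (0, -1)),
   ((-1, 0), (0, -1)), ((0, 0), (-1, -1)), ((0, 0), (0, 1)), ((-1, 0), (0, 1)), ((0, 0), (-1, 1)), ((0, 0), (1, -1)), ((-1, 0), (1, -1)),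
   ((0, 0), (1, 1)), ((-1, 0), (1, 1)), ((0, 1), (0, -1)), ((-1, 1), (0, -1)), ((0, 1), (-1, -1)), ((0, 1), (0, 0)), ((-1, 1), (0, 0)),
   ((0, 1), (-1, 0)), ((0, 1), (1, -1)), ((-1, 1), (1, -1)), ((0, 1), (1, 0)), ((-1, 1), (1, 0)), ((1, -1), (0, 0)), ((1, -1), (-1, 0)),
   ((1, -1), (0, 1)), ((1, -1), (-1, 1)), ((1, 0), (-1, 0)), ((0, 0), (-1, 0)), ((1, 0), (-2, 0)), ((1, 0), (0, -1)), ((1, 0), (-1, -1)),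
   ((1, 0), (0, 1)), ((1, 0), (-1, 1)), ((1, 0), (1, 0)), ((0, 0), (1, 0)), ((1, 0), (0, 0)), ((1, 1), (0, -1)), ((1, 1), (-1, -1)),
   ((1, 1), (0, 0)), ((1, 1), (-1, 0)), ((-2, -1), (1, 0)), ((-2, -1), (1, 1)), ((-2, 0), (0, 0)), ((-1, 0), (-1, 0)), ((-2, 0), (1, -1)),
   ((-2, 0), (1, 1)), ((-1, 0), (2, 0)), ((-2, 0), (2, 0)), ((-2, 1), (1, -1)), ((-2, 1), (1, 0)), ((0, 0), (-2, 0)), ((0, 0), (2, 0)),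
   ((1, -1), (-2, 0)), ((1, -1), (-2, 1)), ((1, -1), (1, 0)), ((1, -1), (1, 1)), ((1, 0), (-2, -1)), ((1, 0), (-2, 1)), ((1, 0), (1, -1)),
   ((1, 0), (1, 1)), ((1, 1), (-2, -1)), ((1, 1), (-2, 0)), ((1, 1), (1, -1)), ((1, 1), (1, 0)), ((2, 0), (-1, 0)), ((2, 0), (-2, 0)),
   ((2, 0), (0, 0))]

/-- the 21 small momenta at which the two-propagator sums `T(q)` and the twisted sums `W(q)` are tabulated
(`q₂, q₃, q₂+q₃` of the keys, the six pair-transform momenta of every low `k`, and their transposes). -/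
def keysQ : List (ℤ × ℤ) :=
  [(-1, 0), (1, 0), (0, 0), (-2, 0), (0, -1), (-1, -1), (0, 1), (-1, 1), (1, -1), (1, 1), (2, 0), (-2, -1), (-2, 1), (2, -1), (2, 1),
   (0, -2), (0, 2), (-1, -2), (1, -2), (-1, 2), (1, 2)]

/-- position of a key in a list (length if absent). -/
def fidx {α : Type} [DecidableEq α] (l : List α) (a : α) : ℕ := l.findIdx (· = a)

/-! ## Exact accumulation at a point -/

/-- componentwise exact sum `acc + (Σ lo·lo'·lo'', Σ hi·hi'·hi'')` of three rows (scale `D³`, no rounding). -/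
def dotP3 : List Iv → List Iv → List Iv → ℤ × ℤ → ℤ × ℤ
  | a :: as, b :: bs, c :: cs, acc => dotP3 as bs cs (acc.1 + a.1 * b.1 * c.1, acc.2 + a.2 * b.2 * c.2)
  | _, _, _, acc => acc

/-- signed weight times a nonnegative interval (both exact, scales multiply). -/
def smulNN (c x : Iv) : ℤ × ℤ :=
  (if 0 ≤ c.1 then c.1 * x.1 else c.1 * x.2, if 0 ≤ c.2 then c.2 * x.2 else c.2 * x.1)

/-- the row of `g` reflected and shifted: entry `p₂ ↦ g(row, (q₂ − p₂) mod L)`. -/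
def rowRefl (L : ℕ) (r : List Iv) (q2 : ℕ) : List Iv := (r.rotate ((q2 + 1) % L)).reverse

/-- `T(q)·D²` exact: `Σ_{p₁} dotP(row p₁, row (p₁+q₁) rotated by q₂)`. -/
def sumT (L : ℕ) (gm : List (List Iv)) (q1 q2 : ℕ) : ℤ × ℤ :=
  psum (fun p1 => dotP (gm.getD p1 []) ((gm.getD ((p1 + q1) % L) []).rotate q2) (0, 0)) L

/-- `G₃(q₂,q₃)·D³` exact: `Σ_p g(p) g(p + s) g(p + t)` with `s = q₂`, `t = −q₃` (natural residues). -/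
def sumG3 (L : ℕ) (gm : List (List Iv)) (s1 s2 t1 t2 : ℕ) : ℤ × ℤ :=
  psum (fun p1 => dotP3 (gm.getD p1 []) ((gm.getD ((p1 + s1) % L) []).rotate s2) ((gm.getD ((p1 + t1) % L) []).rotate t2) (0, 0)) L

/-- the row loop of `sumW`: rows `p₁ < n`. -/
def sumWRow (L : ℕ) (gm : List (List Iv)) (ct ct4 : List Iv) (q1 q2 : ℕ) : ℕ → (ℤ × ℤ) × (ℤ × ℤ)
  | 0 => ((0, 0), (0, 0))
  | p1 + 1 =>
    let acc := sumWRow L gm ct ct4 q1 q2 p1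
    let d := dotP (gm.getD p1 []) (rowRefl L (gm.getD ((q1 + L - p1 % L) % L) []) q2) (0, 0)
    let c := smulNN (getIv ct (p1 % L)) d
    let s := smulNN (getIv ct4 ((4 * (p1 % L) + 3 * L) % (4 * L))) d
    ((acc.1.1 + c.1, acc.1.2 + c.2), (acc.2.1 + s.1, acc.2.2 + s.2))

/-- `(Re W(q), Im W(q))·D³`: `Σ_{p₁} (cos p₁θ, sin p₁θ) · dotP(row p₁, row (q₁−p₁) reflected at q₂)` (signed weights, exact). -/
def sumW (L : ℕ) (gm : List (List Iv)) (ct ct4 : List Iv) (q1 q2 : ℕ) : (ℤ × ℤ) × (ℤ × ℤ) :=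
  sumWRow L gm ct ct4 q1 q2 L

/-- outward rounding from scale `D³` to scale `D`. -/
def round3 (s : ℤ × ℤ) : Iv := (s.1 / (D * D), cdiv s.2 (D * D))

/-! ## The point table -/

/-- the point table at `λ·D = lam`: `T`, `G₃`, `W` (re, im) (all at scale `D`). -/
structure XDPt where
  /-- `T(q)`, `q ∈ keysQ` -/
  tT : List Iv
  /-- `G₃(q₂,q₃)`, `(q₂,q₃) ∈ keys3` -/
  tG3 : List Iv
  /-- `(Re W(q), Im W(q))`, `q ∈ keysQ` -/
  tW : List (Iv × Iv)
  deriving DecidableEq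

/-- ★ the point table from a masked point table `gm` of `g`. -/
def xdPointOf (L : ℕ) (gm : List (List Iv)) : XDPt :=
  let ct := cosTab L
  let ct4 := cosTab (4 * L)
  { tT := keysQ.map fun q => roundP (sumT L gm (modNat L q.1) (modNat L q.2)),
    tG3 := keys3.map fun K => round3 (sumG3 L gm (modNat L K.1.1) (modNat L K.1.2) (modNat L (-K.2.1)) (modNat L (-K.2.2))),
    tW := keysQ.map fun q =>
      let w := sumW L gm ct ct4 (modNat L q.1) (modNat L q.2)
      (round3 w.1, round3 w.2) }

/-- ★ the point table at `λ·D = lam`. -/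
def xdPoint (L : ℕ) (lam : ℤ) : XDPt := xdPointOf L (gPt L lam)

/-! ## Complex fixed-point intervals -/

/-- a complex interval (re, im). -/
abbrev CIv : Type := Iv × Iv

/-- sum. -/
def cadd (x y : CIv) : CIv := (iadd x.1 y.1, iadd x.2 y.2)
/-- product. -/
def cmul (x y : CIv) : CIv := (isub (imul x.1 y.1) (imul x.2 y.2), iadd (imul x.1 y.2) (imul x.2 y.1))
/-- real scaling. -/
def cscal (r : Iv) (z : CIv) : CIv := (imul r z.1, imul r z.2)
/-- conjugate. -/
def cconj (z : CIv) : CIv := (z.1, ineg z.2)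
/-- complex zero. -/
def czero : CIv := ((0, 0), (0, 0))
/-- a real interval as a complex one. -/
def cre (r : Iv) : CIv := (r, (0, 0))

/-! ## The cell evaluator -/

/-- everything the per-momentum assembly needs on the cell. -/
structure XDCell where
  /-- side length -/
  L : ℕ
  /-- `λ·D ∈ [la, lb]` -/
  lam : Iv
  /-- `a = Δ f_nn` -/
  a : Iv
  /-- `c_s` -/
  cs : Iv
  /-- `f_nn` -/
  fnn : Iv
  /-- `A = V + a` -/
  A : Iv
  /-- `S₁ = Σ_p g(p) = V·G̃(0)` -/
  S1 : Iv
  /-- `G̃(x̂)` -/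
  gx : Iv
  /-- `ε₁` -/
  eps1 : Iv
  /-- `T⁺ − 3λ₂ = Q/P` -/
  nt : Iv
  /-- cell table of `g` -/
  gt : List (List Iv)
  /-- cell enclosures of `T(q)`, `q ∈ keysQ` -/
  cT : List Iv
  /-- cell enclosures of `G₃`, keys `keys3` -/
  cG3 : List Iv
  /-- cell enclosures of `W(q)`, `q ∈ keysQ` -/
  cW : List CIv
  /-- cosine table (mod `L`) -/
  ct : List Iv
  /-- cosine table (mod `4L`) -/
  ct4 : List Iv

/-- widen a complex point value by `±rad`. -/
def cwiden (z : CIv) (rad : ℤ) : CIv := ((z.1.1 - rad, z.1.2 + rad), (z.2.1 - rad, z.2.2 + rad))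

/-- ★ the cell data from the two point tables (lower ends at `la`, upper ends at `lb`; `W(q)` = point value at `la` widened by
the variation `T⁺(q) − T⁻(q)` of the two-propagator sum over the cell; `G̃(x̂)` = point value at `la` plus `[0, h]·`slope enclosure). -/
def xdCell (L : ℕ) (la lb : ℤ) (ptLo ptHi : XDPt) : XDCell :=
  let V : ℕ := L * L
  let ct := cosTab L
  let gt := gresCellTab L ct la lb
  let E := xbEval L la lb
  let S := E.1
  let O := E.2
  let cT : List Iv := (List.range keysQ.length).map fun i => ((getIv ptLo.tT i).1, (getIv ptHi.tT i).2)
  { L := L, lam := (la, lb), a := S.a, cs := S.cs, fnn := iadd S.a (idivn (iscale V (la, lb)) 4),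
    A := iadd (iconst (V : ℤ)) S.a,
    S1 := iscale V (G0Iv L la lb),
    gx := iadd (GresCellIv L la la 1 0) (imul (0, lb - la) (GresSlopeIv L la lb 1 0)),
    eps1 := S.eps1,
    nt := imul O.Q (iinv O.P),
    gt := gt,
    cT := cT,
    cG3 := (List.range keys3.length).map fun i => ((getIv ptLo.tG3 i).1, (getIv ptHi.tG3 i).2),
    cW := (List.range keysQ.length).map fun i =>
      cwiden (ptLo.tW.getD i ((0, 0), (0, 0))) ((getIv cT i).2 - (getIv cT i).1),
    ct := ct, ct4 := cosTab (4 * L) }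

namespace XDCell

variable (C : XDCell)

/-- is `q ≡ 0`? -/
def isZ (q : ℤ × ℤ) : Bool := decide (modNat C.L q.1 = 0 ∧ modNat C.L q.2 = 0)
/-- `g(q)` on the cell (`0` at the origin). -/
def g (q : ℤ × ℤ) : Iv := gAt C.gt (modNat C.L q.1) (modNat C.L q.2)
/-- `B(q) = −a − c_s g(q)` (`B(0) = −a`). -/
def B (q : ℤ × ℤ) : Iv := if C.isZ q then ineg C.a else ineg (iadd C.a (imul C.cs (C.g q)))
/-- `T(q)` from the cell table. -/
def T (q : ℤ × ℤ) : Iv := getIv C.cT (fidx keysQ q)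
/-- `G₃(q₂,q₃)` from the cell table. -/
def G3 (K : (ℤ × ℤ) × (ℤ × ℤ)) : Iv := getIv C.cG3 (fidx keys3 K)
/-- `W_{x̂}(q)` from the cell table. -/
def Wx (q : ℤ × ℤ) : CIv := C.cW.getD (fidx keysQ q) czero
/-- `W_e(q)` for the directions `j = 0,1,2,3` (`x̂, −x̂, ŷ, −ŷ`): conjugate for `−e`, transpose for `ŷ`. -/
def W (j : ℕ) (q : ℤ × ℤ) : CIv :=
  if j = 0 then C.Wx q else if j = 1 then cconj (C.Wx q)
  else if j = 2 then C.Wx (q.2, q.1) else cconj (C.Wx (q.2, q.1))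
/-- `q·e_j` as an integer. -/
def dotE (j : ℕ) (q : ℤ × ℤ) : ℤ := if j = 0 then q.1 else if j = 1 then -q.1 else if j = 2 then q.2 else -q.2
/-- `e^{i m θ}` as a complex interval (`cos` from the table mod `L`, `sin` from the table mod `4L`). -/
def expI (m : ℤ) : CIv :=
  let n := modNat C.L m
  (getIv C.ct n, getIv C.ct4 ((4 * n + 3 * C.L) % (4 * C.L)))
/-- `e^{−i q·e_j}`. -/
def phN (j : ℕ) (q : ℤ × ℤ) : CIv := cconj (C.expI (dotE j q))
/-- `δ(q)` as `0/1` interval. -/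
def dl (q : ℤ × ℤ) : Iv := if C.isZ q then ione else (0, 0)

/-- ★ `Π̂(q₂,q₃)` on the cell (`piHat_expansion_ground`). -/
def piHat (K : (ℤ × ℤ) × (ℤ × ℤ)) : Iv :=
  let V : ℕ := C.L * C.L
  let q2 := K.1
  let q3 := K.2
  let q23 : ℤ × ℤ := (q2.1 + q3.1, q2.2 + q3.2)
  let B2 := C.B q2
  let B3 := C.B q3
  let B23 := C.B q23
  let A := C.A
  let t0 := if C.isZ q2 && C.isZ q3 then imul (imul A A) A else (0, 0)
  let t1 := imul (imul A A) (iadd (iadd (if C.isZ q2 then B3 else (0, 0)) (if C.isZ q3 then B2 else (0, 0)))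
              (if C.isZ q23 then B2 else (0, 0)))
  let t2 := imul A (iadd (iadd (imul B2 B3) (imul B2 B23)) (imul B3 B23))
  let sbbb := ineg (iadd (iadd (iadd (iscale V (imul (imul C.a C.a) C.a))
                (iscale 3 (imul (imul (imul C.a C.a) C.cs) C.S1)))
                (imul (imul C.a (imul C.cs C.cs)) (iadd (iadd (C.T q2) (C.T q3)) (C.T q23))))
                (imul (imul C.cs (imul C.cs C.cs)) (C.G3 K)))
  idivn (iadd (iadd (iadd t0 t1) t2) sbbb) V

/-- ★ `Y_e(q)` on the cell: `(1/V)[A²δ(q) + A B(q)(1 + e^{−iq·e}) + a c_s V G̃(x̂)(1 + e^{−iq·e}) + c_s² e^{−iq·e} W_e(q)]`. -/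
def Y (j : ℕ) (q : ℤ × ℤ) : CIv :=
  let V : ℕ := C.L * C.L
  let ph := C.phN j q
  let onep := cadd (cre ione) ph
  let t1 := cre (imul (imul C.A C.A) (C.dl q))
  let t2 := cscal (imul C.A (C.B q)) onep
  let t3 := cscal (iscale V (imul (imul C.a C.cs) C.gx)) onep
  let t4 := cscal (imul C.cs C.cs) (cmul ph (C.W j q))
  let s := cadd (cadd (cadd t1 t2) t3) t4
  (idivn s.1 V, idivn s.2 V)

/-- `Ψ̂¹(k)`. -/
def psi (k : (ℤ × ℤ) × (ℤ × ℤ)) : Iv := ((trans3 k).map C.piHat).foldr iadd (0, 0)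

/-- `1 + e^{iK₁·e_j}`. -/
def wf (j : ℕ) : CIv := cadd (cre ione) (C.expI (dotE j (1, 0)))

/-- the direction-`j` summands of `FTW(k)/f_nn` and `Bd(k)/f_nn`. -/
def ftwBdDir (k : (ℤ × ℤ) × (ℤ × ℤ)) (j : ℕ) : CIv × CIv :=
  let k2 := k.1
  let k3 := k.2
  let k2m : ℤ × ℤ := (k2.1 - 1, k2.2)
  let k3m : ℤ × ℤ := (k3.1 - 1, k3.2)
  let k23 : ℤ × ℤ := (k2.1 + k3.1, k2.2 + k3.2)
  let k23m : ℤ × ℤ := (k2.1 + k3.1 - 1, k2.2 + k3.2)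
  let jn := if j = 0 then 1 else if j = 1 then 0 else if j = 2 then 3 else 2
  let c2 := C.phN j k2
  let c3 := C.phN j k3
  let w := C.wf j
  ( cadd (cadd (cmul c2 (cadd (cmul w (C.Y j k3)) (C.Y j k3m))) (cmul c3 (cadd (cmul w (C.Y j k2)) (C.Y j k2m))))
      (cmul c3 (cadd (C.Y jn k23) (cmul w (C.Y jn k23m)))),
    cadd (cadd (cadd (cmul w (cadd (C.Y j k2) (C.Y j k3))) (C.Y j k2m)) (cadd (C.Y j k3m) (C.Y jn k23)))
      (cmul w (C.Y jn k23m)) )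

/-- `FTW(k)/f_nn` and `Bd(k)/f_nn` (the four-direction sum). -/
def ftwBd (k : (ℤ × ℤ) × (ℤ × ℤ)) : CIv × CIv :=
  ((List.range 4).map (C.ftwBdDir k)).foldr (fun p acc => (cadd p.1 acc.1, cadd p.2 acc.2)) (czero, czero)

/-- `ε(q) = 2 − cos q₁θ − cos q₂θ` on the cell (exact up to the table). -/
def eps (q : ℤ × ℤ) : Iv := epsIv C.ct 0 (modNat C.L q.1) (modNat C.L q.2)

/-- `Σε − ε₁ − 3λ` at `k` (the denominator without the small `T⁺ − 3λ₂`). -/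
def denMain (k : (ℤ × ℤ) × (ℤ × ℤ)) : Iv :=
  isub (isub (iadd (iadd (C.eps (1 - k.1.1 - k.2.1, -k.1.2 - k.2.2)) (C.eps k.1)) (C.eps k.2)) C.eps1) (iscale 3 C.lam)

/-- ★ the box of `R̂′(k) = den·Ψ̂¹ − a·(FTW/f_nn) + f_nn·(Bd/f_nn)` and the lower end of `den(k)`. -/
def rhat (k : (ℤ × ℤ) × (ℤ × ℤ)) : CIv × ℤ :=
  let dm := C.denMain k
  let den := isub dm C.nt
  let fb := C.ftwBd k
  let P := C.psi k
  (cadd (cadd (cre (imul den P)) (cscal (ineg C.a) fb.1)) (cscal C.fnn fb.2), dm.1 - C.nt.2)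

/-- `max(|lo|,|hi|)` of an interval. -/
def amax (I : Iv) : ℤ := max (I.1.natAbs : ℤ) (I.2.natAbs : ℤ)

/-- ★ `D · Σ_k |R̂′(k)|²⁺ / den⁻(k)` as an exact rational, and the positivity of every `den⁻`. -/
def lowGSum : ℚ × Bool :=
  (xdLow.map C.rhat).foldr (fun r acc =>
    (acc.1 + (((amax r.1.1) ^ 2 + (amax r.1.2) ^ 2 : ℤ) : ℚ) / ((r.2 : ℤ) : ℚ), acc.2 && decide (0 < r.2))) (0, true)

end XDCell

/-- ★ THE XD CELL CERTIFICATE of the row-D crux at this `L` on `[la, lb]` with constant `aD`, given the two point tables: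
g4's ground-cell check, `1 − Δ > 0`, positive point denominators at `la`, nonnegative point tables of `g` at both ends, `P⁻ > 0`, every `den⁻ > 0`, `0 ≤ aD`,
`T⁺⁻ = 3λ⁻ + (Q/P)⁻ ≥ 0`, and `D·Σ|R̂′|²⁺/den⁻ ≤ aD · V² · (V λ⁻/4) · 3V² T⁺⁻ · D` (i.e. `lowG ≤ aD η_eff U`). -/
def xdCellOK (L : ℕ) (la lb : ℤ) (aD : ℚ) (ptLo ptHi : XDPt) : Bool :=
  let E := xbEval L la lb
  let C := xdCell L la lb ptLo ptHi
  let s := C.lowGSum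
  let V : ℚ := (((L : ℤ) * L : ℤ) : ℚ)
  let tlo : ℚ := ((3 * la + C.nt.1 : ℤ) : ℚ) / ((D : ℤ) : ℚ)
  let etalo : ℚ := V * (la : ℚ) / (4 * ((D : ℤ) : ℚ))
  groundCellCheck L la lb && xbScalOK L la lb && denCellPos L (cosTab L) la la && gPtNonneg L la && gPtNonneg L lb &&
    decide (0 < E.2.P.1) && s.2 && decide (0 ≤ aD) && decide (0 ≤ tlo) &&
    decide (s.1 ≤ aD * V ^ 2 * etalo * (3 * V ^ 2 * tlo) * ((D : ℤ) : ℚ))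

/-- ★ the certificate with the point tables recomputed in the kernel (small `L`); a kernel fact may instead rewrite
`xdPoint L la`, `xdPoint L lb` to certified literal tables. -/
def xdCellOK0 (L : ℕ) (la lb : ℤ) (aD : ℚ) : Bool := xdCellOK L la lb aD (xdPoint L la) (xdPoint L lb)

end FinXD

end Summit.HubbardSuperconductivity.HubbardSuperconductivity.Theorems.AnisotropyChord.Transfer.Fibre3
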